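import Summits.HodgeConjecture.HodgeConjecture.Theorems.H413ThetaDistNeZeroOfThetaLift
import Summits.HodgeConjecture.HodgeConjecture.Theorems.H413FinCharZeroUnitary
import Literature.RepresentationTheory.CompactGroups.CharacterCompleteness
import HarnessLib

/-!
# FLOOR-0 P4, S4b — THE `(χ)`-ROW AND THE `hne`-ROW FOR ONE AND THE SAME CHARACTER `χ̃`: the pin character read back on `[U(1)]`

Cell hodgecm-mathlib (D-0151), FLOOR 0, crux item H413 = stmt-HodgeConjecture-24833; programme P4, line
`Cruxes/H413/Lines/F0_P4AdmissibleOccursInH1.lean` ED. 2, stub S4b `stub_T3a_holThetaAtAdmissibleLineOfRallisAt`; F0P4-p01 (g0)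
2026-08-31T00:20:29Z («p02∕p05: hχ, hne»).  Author F0P4-p05 (g0).  `--supports stmt-HodgeConjecture-24833` (helper).  DEF-FREE.
Namespace `Summit.HodgeConjecture.HodgeConjecture.Cruxes.H413.RallisTransport`.

THE POINT.  The S4b reduction theorem ★ `ThetaJunction.exists_holTheta_atLine_of_inputs` (p797429) asks, for SOME character
`χ̃ : PontryaginDual [U(1)]` and SOME `χ₁ : U(⟨a₀⟩)(𝔸_f) →* ℂˣ`, the two rows
* `hχ  : ∀ u, D.chiFin χ̃ u = finCharZero … η₀ (1, u) · χ₁ u`,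
* `hne : ∃ Φ_f, D.dist (charInv χ̃) Φ_f ≠ 0`,
and nothing forces `χ̃` to be trivial on the archimedean torus.  Building `χ̃` from FINITE characters (★ brick 9b `exists_chiFin_eq_mul`) needs
the rationality inputs `herat`∕`hχrat` — and `herat` for `e = finCharZero(1,·)` alone is NOT a consequence of automorphy (the finite part of an
automorphic character kills the rational points iff its archimedean part does).  This file takes the other road, on which NO rationality ∕
continuity ∕ unitarity input is left: `χ̃` is READ OFF the producer.  The ★ `hne` bridge `exists_dist_ne_zero_of_pin_thetaLift_ne_zero` (p796018) turns
ONE non-zero theta lift of S6's pair AT THE PIN SPLITTING `s` (`splittingOf hGR₀ = s ⊗ ĉ`), of the test function `charCM χ₂` of a character `χ₂` of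
`[U(⟨a₀⟩)]`, into `D.dist (((charCM χ₂ · κ₂) ∘ a) · κ₁) Φ_f ≠ 0` (`κ₂ = ĉ(1 ⊗ ·)`, `κ₁ =` the J-R multiplier `t ↦ η₀(1,t♭)·χ₀(1,e t)`,
`a = cosetCongr e`, `e = cmLineTorusEquiv`).  The weight `w := ((charCM χ₂ · κ₂) ∘ a) · κ₁` is a continuous multiplicative norm-one function on
the COMPACT group `[U(1)]`, i.e. (★ `exists_pontryaginDual_coe_eq`) `w = charInv χ̃` for a unique `χ̃ : PontryaginDual [U(1)]`
(**`exists_pontryaginDual_charInv_eq`**).  For THIS `χ̃`: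

* **`hne`** is the bridge's conclusion verbatim (**`exists_dist_charInv_ne_zero_of_pin_thetaLift_ne_zero`**);
* **`hχ`** holds BY BOOKKEEPING (**`chiFin_eq_of_charInv_eq`**): `D.chiFin χ̃ u = χ̃([t_u])⁻¹ = w([t_u])` at `t_u = finLineTorusIdeles u`
  (`D.toIdele = finLineTorusIdeles ∘ φ`, ★ `distDatumAt_toIdele`), and `w([t_u]) = χ₂([e t_u]) · ĉ(1 ⊗ e t_u) · (η₀(1,t_u♭)·χ₀(1,e t_u))`
  with `e t_u = (1_∞, u)` (**`cmLineTorusEquiv_finLineTorusIdeles`**) and `η₀(1,t_u♭)·χ₀(1,(1_∞,u)) = finCharZero … η₀ (1, u)`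
  (★ `finCharZero_one_eq_twistMultiplier`, p797625).  Hence
  **`D.chiFin χ̃ u = finCharZero … η₀ (1, φ u) · (ĉ (1 ⊗ (1_∞, φ u)) · χ₂([(1_∞, φ u)]))`** — the `(χ)`-row with the EXPLICIT
  `χ₁ := (ĉ ∘ adelicInr ∘ finAdelicToAdelic) · (toUnits ∘ χ₂ ∘ mk ∘ finAdelicToAdelic)`;
* **`exists_chiRow_and_hne_of_pin_thetaLift_ne_zero`** packages the three (`charInv χ̃ = w`, `hne`, `hχ`).

What this leaves to the junction (F0P4-p01, by name): the row `hΨ` for THIS `χ₁`, i.e. (i) `χ₂ ∘ mk ∘ finAdelicToAdelic =` the finite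
character the (FIN) computation is run with (Liu's `lineChar a χ`, ★ brick 9 `cmCentreFinCharQuot` when `χ₂` is taken trivial at `∞`), and
(ii) `ĉ ∘ adelicInr ∘ finAdelicToAdelic = (χtw ∘ inr)⁻¹` (the identification of the junction twist with the splitting ratio `ĉ`).  The
archimedean consistency lives entirely on the producer's side (S6's rows `(A)`∕`(χ)`: `χ₂`'s archimedean part is the eigencharacter of the
harmonic vector); `χ̃`'s own archimedean part is then `(χ₂ ∘ a · ĉ(1 ⊗ ·) ∘ a · κ₁)⁻¹` restricted to `U(1)(L⁺ ⊗ ℝ)`, whatever it is — no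
condition.  HC_CM is proved only modulo the printed citations until rung 0 closes; this file proves nothing about them.

## References (conventions only; nothing of print is asserted)
* [Li1992] J.-S. Li, J. reine angew. Math. 428 (1992), Thm 2.1 (26) p. 184, p. 178.
* [GelbartRogawski1991] S. Gelbart, J. Rogawski, Invent. Math. 105 (1991), §3.1 Remark p. 457 L4–13.
* [Godement1964] R. Godement, Sém. Bourbaki 171 (1958∕59), §5 Thm. 4 (characters of compact abelian groups).
* [Liu2021] Y. Liu, Camb. J. Math. 9 (2021) = arXiv:2102.11518, proof of Prop. 4.13 (l. 2145); App. D §D.1 Step 3.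
-/

set_option autoImplicit false
set_option linter.dupNamespace false

noncomputable section

open _root_.MeasureTheory
open NumberField hiding relNormOneIdeles relNormOneRat probHaarRelNormOneQuot
open scoped Matrix TensorProduct ComplexConjugate
open Literature.NumberTheory.Automorphic Literature.NumberTheory.Automorphic.UnitaryGroup Literature.NumberTheory.Weil1964
open Literature.NumberTheory.Weil1964.ThetaKernelDatum
open Literature.NumberTheory.GelbartRogawski1991 Literature.NumberTheory.GelbartRogawski1991.UnitaryDualPair
open Literature.MeasureTheory.Group
open HodgeCM HodgeCM.Adelic HodgeCM.PerL34 HodgeCM.Model HodgeCM.Model.ArchSideTerm HodgeCM.Model.SupplyResidual HodgeCM.Model.ThetaAdelicSide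
open HodgeCM.Model.ThetaDistFin
open HodgeCM.Model.SupplyResidual.WeilPairData (charInv charInv_apply)
open Summit.HodgeConjecture.HodgeConjecture.Cruxes.H413.ThetaNonvanishing

namespace Summit.HodgeConjecture.HodgeConjecture.Cruxes.H413.RallisTransport

variable {L : CMField} {ι₁ : L →+* ℂ} (V : HermSpace3 L ι₁) (hV : IsAnisotropic L V.Hm) (Sw : StubTree.SeesawDatum L)
variable
  (hGR : (cmSplittingDatum (L : Type) finProdFinEquiv (frameD V) (frameD_real V) (frameD_ne V) (dW Sw) (dW_real Sw) (dW_ne Sw)).CompatibleSplitting)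
  (hGR₀ : (cmSplittingDatum (L : Type) (e₁) (frameD V) (frameD_real V) (frameD_ne V) (lineVec (L : Type) (dW Sw 0))
    (fun _ => dW_real Sw 0) (fun _ => dW_ne Sw 0)).CompatibleSplitting)
  (hGR₁ : (cmSplittingDatum (L : Type) (e₁) (frameD V) (frameD_real V) (frameD_ne V) (lineVec (L : Type) (dW Sw 1))
    (fun _ => dW_real Sw 1) (fun _ => dW_ne Sw 1)).CompatibleSplitting)
  (hGR₂ : (cmSplittingDatum (L : Type) (e₁) (frameD V) (frameD_real V) (frameD_ne V) (lineVec (L : Type) (dW' Sw 0))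
    (fun _ => dW'_real Sw 0) (fun _ => dW'_ne Sw 0)).CompatibleSplitting)
  (hGR₃ : (cmSplittingDatum (L : Type) (e₁) (frameD V) (frameD_real V) (frameD_ne V) (lineVec (L : Type) (dW' Sw 1))
    (fun _ => dW'_real Sw 1) (fun _ => dW'_ne Sw 1)).CompatibleSplitting)
  (η₀ η₁ η₂ η₃ : CMAdelic (L : Type) (frameD V) × CMAdelicOne (L : Type) →* ℂˣ)
  -- the model side and its slot-0 product datum
  {c' : SeesawCtx L} (S : ThetaAdelicSide V c') (hSω : (S.P 0).ω = lineRepOf V Sw hGR hGR₀ hGR₁ hGR₂ hGR₃ η₀ η₁ η₂ η₃ 0)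
  (D : S.ThetaDistDatum hV 0)
  (κ₁ : C(↥(relNormOneIdeles (↥(maximalRealSubfield L)) L) ⧸ relNormOneRat (↥(maximalRealSubfield L)) L, ℂ))
  (hκ₁ : ∀ t : ↥(relNormOneIdeles (↥(maximalRealSubfield L)) L),
    κ₁ (QuotientGroup.mk t) =
      ((η₀ (1, (cmAdelicOneEquivRelNormOne (L : Type)).symm t) *
          cmLineChar₀ (L : Type) finProdFinEquiv e₁ (frameD V) (frameD_real V) (frameD_ne V) (dW Sw) (dW_real Sw) (dW_ne Sw)
            hGR hGR₀ hGR₁ (1, cmLineTorusEquiv (L : Type) (dW Sw 0) (dW_ne Sw 0) t) : ℂˣ) : ℂ))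

/-! ## §0 Torus bookkeeping: `e (finLineTorusIdeles u) = (1_∞, u)` -/

/-- `cmLineTorusEquiv (finLineTorusIdeles u) = finAdelicToAdelic u`: the idelic torus point of `u ∈ U(⟨a₀⟩)(𝔸_f)` read back in
`U(⟨a₀⟩)(𝔸)` is `(1_∞, u)` (★ `cmLineTorusEquiv_apply`, ★ `cmCenter_finLineTorus`). [cite: Mok2014, §1 Notation p. 5] -/
theorem cmLineTorusEquiv_finLineTorusIdeles (u : UfZero Sw) :
    cmLineTorusEquiv (L : Type) (dW Sw 0) (dW_ne Sw 0) (finLineTorusIdeles (L : Type) (dW Sw 0) (dW_ne Sw 0) u) =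
      UnitaryGroup.finAdelicToAdelic (↥(maximalRealSubfield L)) (L : Type) (IsCMField.complexConj L) 1
        (Matrix.diagonal (lineVec (L : Type) (dW Sw 0))) u := by
  rw [cmLineTorusEquiv_apply, cmAdelicOneEquivRelNormOne_symm_finLineTorusIdeles, cmCenter_finLineTorus]

/-! ## §1 The weight `w = ((charCM χ₂ · κ₂) ∘ a) · κ₁` on `[U(1)]` is a character: `w = charInv χ̃` -/

include hκ₁ in
/-- the J-R multiplier descends to `1 ↦ 1`. [cite: GelbartRogawski1991, §3.1 Remark p. 457 L4–13] -/
theorem jrMultiplier_one : κ₁ 1 = 1 := by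
  rw [← QuotientGroup.mk_one, hκ₁]
  simp only [map_one, Prod.mk_one_one, one_mul, Units.val_one]

include hκ₁ in
/-- the J-R multiplier is multiplicative on `[U(1)]`. [cite: GelbartRogawski1991, §3.1 Remark p. 457 L4–13] -/
theorem jrMultiplier_mul (x y : ↥(relNormOneIdeles (↥(maximalRealSubfield L)) L) ⧸ relNormOneRat (↥(maximalRealSubfield L)) L) : κ₁ (x * y) = κ₁ x * κ₁ y := by
  induction x using QuotientGroup.induction_on with
  | H t =>
    induction y using QuotientGroup.induction_on with
    | H t' =>
      rw [← QuotientGroup.mk_mul, hκ₁, hκ₁, hκ₁, map_mul, map_mul]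
      have h1 : (((1 : CMAdelic (L : Type) (frameD V)),
            (cmAdelicOneEquivRelNormOne (L : Type)).symm t * (cmAdelicOneEquivRelNormOne (L : Type)).symm t') :
            CMAdelic (L : Type) (frameD V) × CMAdelicOne (L : Type)) =
          (1, (cmAdelicOneEquivRelNormOne (L : Type)).symm t) * (1, (cmAdelicOneEquivRelNormOne (L : Type)).symm t') := by
        rw [Prod.mk_mul_mk, one_mul]
      have h2 : (((1 : CMAdelic (L : Type) (frameD V)), cmLineTorusEquiv (L : Type) (dW Sw 0) (dW_ne Sw 0) t * cmLineTorusEquiv (L : Type) (dW Sw 0) (dW_ne Sw 0) t') :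
            CMAdelic (L : Type) (frameD V) × CMAdelic (L : Type) (lineVec (L : Type) (dW Sw 0))) =
          (1, cmLineTorusEquiv (L : Type) (dW Sw 0) (dW_ne Sw 0) t) * (1, cmLineTorusEquiv (L : Type) (dW Sw 0) (dW_ne Sw 0) t') := by
        rw [Prod.mk_mul_mk, one_mul]
      rw [h1, h2, map_mul, map_mul]
      simp only [Units.val_mul]
      ring

variable
  [(CMRat (L : Type) (lineVec (L : Type) (dW Sw 0))).Normal]
  -- the splitting ratio `ĉ` (`splittingOf hGR₀ = s ⊗ ĉ`) and the two descended multipliers of the `hne` bridge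
  (ĉ : ↥(UnitaryGroup.adelicPair (↥(maximalRealSubfield L)) (L : Type) (IsCMField.complexConj L) 3 1
      (Matrix.diagonal (frameD V)) (Matrix.diagonal (lineVec (L : Type) (dW Sw 0)))) →* ℂˣ)
  (κ₂ : C(CMAdelic (L : Type) (lineVec (L : Type) (dW Sw 0)) ⧸ CMRat (L : Type) (lineVec (L : Type) (dW Sw 0)), ℂ))
  (hκ₂ : ∀ h : CMAdelic (L : Type) (lineVec (L : Type) (dW Sw 0)),
    κ₂ (QuotientGroup.mk h) =
      ((ĉ (UnitaryGroup.adelicInr (↥(maximalRealSubfield L)) (L : Type) (IsCMField.complexConj L) 3 1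
        (Matrix.diagonal (frameD V)) (Matrix.diagonal (lineVec (L : Type) (dW Sw 0))) h) : ℂˣ) : ℂ))
  (χ₂ : PontryaginDual (CMAdelic (L : Type) (lineVec (L : Type) (dW Sw 0)) ⧸ CMRat (L : Type) (lineVec (L : Type) (dW Sw 0))))

include hκ₂ in
/-- the splitting multiplier descends to `1 ↦ 1`. [cite: GelbartRogawski1991, §3.1 Remark p. 457 L4–13] -/
theorem splittingMultiplier_one : κ₂ 1 = 1 := by
  rw [← QuotientGroup.mk_one, hκ₂, map_one, map_one, Units.val_one]

include hκ₂ in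
/-- the splitting multiplier is multiplicative on `[U(⟨a₀⟩)]`. [cite: GelbartRogawski1991, §3.1 Remark p. 457 L4–13] -/
theorem splittingMultiplier_mul (x y : CMAdelic (L : Type) (lineVec (L : Type) (dW Sw 0)) ⧸ CMRat (L : Type) (lineVec (L : Type) (dW Sw 0))) : κ₂ (x * y) = κ₂ x * κ₂ y := by
  induction x using QuotientGroup.induction_on with
  | H g =>
    induction y using QuotientGroup.induction_on with
    | H g' => rw [← QuotientGroup.mk_mul, hκ₂, hκ₂, hκ₂, map_mul, map_mul, Units.val_mul]

/-- **a continuous multiplicative `w` on the compact `[U(1)]` with `w 1 = 1` is `charInv χ̃`** for a (unique) Pontryagin-dual element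
`χ̃` — unitary by ★ `norm_eq_one_of_map_mul_of_compactSpace`, then ★ `exists_pontryaginDual_coe_eq` applied to `conj ∘ w`.
[cite: Godement1964, §5 Thm. 4] -/
theorem exists_pontryaginDual_charInv_eq_of (w : C(↥(relNormOneIdeles (↥(maximalRealSubfield L)) L) ⧸ relNormOneRat (↥(maximalRealSubfield L)) L, ℂ)) (h1 : w 1 = 1)
    (hmul : ∀ x y, w (x * y) = w x * w y) :
    ∃ χ : PontryaginDual (↥(relNormOneIdeles (↥(maximalRealSubfield L)) L) ⧸ relNormOneRat (↥(maximalRealSubfield L)) L), charInv χ = w := by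
  have hnorm : ∀ x, ‖w x‖ = 1 := norm_eq_one_of_map_mul_of_compactSpace w h1 hmul
  have h1' : star w 1 = 1 := by rw [ContinuousMap.star_apply, h1, star_one]
  have hmul' : ∀ x y, star w (x * y) = star w x * star w y := fun x y => by
    rw [ContinuousMap.star_apply, ContinuousMap.star_apply, ContinuousMap.star_apply, hmul, star_mul']
  have hnorm' : ∀ x, ‖star w x‖ = 1 := fun x => by rw [ContinuousMap.star_apply, norm_star, hnorm]
  obtain ⟨χ, hχ⟩ := exists_pontryaginDual_coe_eq (star w) h1' hmul' hnorm'
  refine ⟨χ, ContinuousMap.ext fun x => ?_⟩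
  rw [charInv_apply, map_inv, Circle.coe_inv_eq_conj, hχ, ContinuousMap.star_apply, starRingEnd_apply, star_star]

/-- the weight `w = ((charCM χ₂ · κ₂) ∘ cosetCongr e) · κ₁` on representatives (definitional).
[cite: GelbartRogawski1991, §3.1 Remark p. 457 L4–13] -/
theorem pinWeight_mk (t : ↥(relNormOneIdeles (↥(maximalRealSubfield L)) L)) :
    ((Literature.RepresentationTheory.CompactGroups.charCM χ₂ * κ₂).comp
              ⟨cosetCongr (cmLineTorusEquiv (L : Type) (dW Sw 0) (dW_ne Sw 0)) (relNormOneRat (↥(maximalRealSubfield L)) L)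
                  (CMRat (L : Type) (lineVec (L : Type) (dW Sw 0))) (cmLineTorusEquiv_mem_CMRat_iff (L : Type) (dW Sw 0) (dW_ne Sw 0)),
                continuous_cosetCongr _ _ _ _ (continuous_cmLineTorusEquiv (L : Type) (dW Sw 0) (dW_ne Sw 0))⟩ * κ₁) (QuotientGroup.mk t) =
      ((χ₂ (QuotientGroup.mk (cmLineTorusEquiv (L : Type) (dW Sw 0) (dW_ne Sw 0) t)) : Circle) : ℂ) * κ₂ (QuotientGroup.mk (cmLineTorusEquiv (L : Type) (dW Sw 0) (dW_ne Sw 0) t)) * κ₁ (QuotientGroup.mk t) :=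
  rfl

include hκ₁ hκ₂ in
/-- `w 1 = 1`. [cite: GelbartRogawski1991, §3.1 Remark p. 457 L4–13] -/
theorem pinWeight_one :
    ((Literature.RepresentationTheory.CompactGroups.charCM χ₂ * κ₂).comp
              ⟨cosetCongr (cmLineTorusEquiv (L : Type) (dW Sw 0) (dW_ne Sw 0)) (relNormOneRat (↥(maximalRealSubfield L)) L)
                  (CMRat (L : Type) (lineVec (L : Type) (dW Sw 0))) (cmLineTorusEquiv_mem_CMRat_iff (L : Type) (dW Sw 0) (dW_ne Sw 0)),
                continuous_cosetCongr _ _ _ _ (continuous_cmLineTorusEquiv (L : Type) (dW Sw 0) (dW_ne Sw 0))⟩ * κ₁) 1 = 1 := by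
  rw [← QuotientGroup.mk_one, pinWeight_mk, map_one, QuotientGroup.mk_one, QuotientGroup.mk_one, map_one,
    splittingMultiplier_one V Sw ĉ κ₂ hκ₂, jrMultiplier_one V Sw hGR hGR₀ hGR₁ η₀ κ₁ hκ₁, Circle.coe_one, one_mul, one_mul]

include hκ₁ hκ₂ in
/-- `w` is multiplicative. [cite: GelbartRogawski1991, §3.1 Remark p. 457 L4–13] -/
theorem pinWeight_mul (x y : ↥(relNormOneIdeles (↥(maximalRealSubfield L)) L) ⧸ relNormOneRat (↥(maximalRealSubfield L)) L) :
    ((Literature.RepresentationTheory.CompactGroups.charCM χ₂ * κ₂).comp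
              ⟨cosetCongr (cmLineTorusEquiv (L : Type) (dW Sw 0) (dW_ne Sw 0)) (relNormOneRat (↥(maximalRealSubfield L)) L)
                  (CMRat (L : Type) (lineVec (L : Type) (dW Sw 0))) (cmLineTorusEquiv_mem_CMRat_iff (L : Type) (dW Sw 0) (dW_ne Sw 0)),
                continuous_cosetCongr _ _ _ _ (continuous_cmLineTorusEquiv (L : Type) (dW Sw 0) (dW_ne Sw 0))⟩ * κ₁) (x * y) =
      ((Literature.RepresentationTheory.CompactGroups.charCM χ₂ * κ₂).comp
              ⟨cosetCongr (cmLineTorusEquiv (L : Type) (dW Sw 0) (dW_ne Sw 0)) (relNormOneRat (↥(maximalRealSubfield L)) L)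
                  (CMRat (L : Type) (lineVec (L : Type) (dW Sw 0))) (cmLineTorusEquiv_mem_CMRat_iff (L : Type) (dW Sw 0) (dW_ne Sw 0)),
                continuous_cosetCongr _ _ _ _ (continuous_cmLineTorusEquiv (L : Type) (dW Sw 0) (dW_ne Sw 0))⟩ * κ₁) x *
        ((Literature.RepresentationTheory.CompactGroups.charCM χ₂ * κ₂).comp
              ⟨cosetCongr (cmLineTorusEquiv (L : Type) (dW Sw 0) (dW_ne Sw 0)) (relNormOneRat (↥(maximalRealSubfield L)) L)
                  (CMRat (L : Type) (lineVec (L : Type) (dW Sw 0))) (cmLineTorusEquiv_mem_CMRat_iff (L : Type) (dW Sw 0) (dW_ne Sw 0)),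
                continuous_cosetCongr _ _ _ _ (continuous_cmLineTorusEquiv (L : Type) (dW Sw 0) (dW_ne Sw 0))⟩ * κ₁) y := by
  induction x using QuotientGroup.induction_on with
  | H t =>
    induction y using QuotientGroup.induction_on with
    | H t' =>
      rw [← QuotientGroup.mk_mul, pinWeight_mk, pinWeight_mk, pinWeight_mk, map_mul, QuotientGroup.mk_mul, QuotientGroup.mk_mul, map_mul,
        Circle.coe_mul, splittingMultiplier_mul V Sw ĉ κ₂ hκ₂, jrMultiplier_mul V Sw hGR hGR₀ hGR₁ η₀ κ₁ hκ₁]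
      ring

include hκ₁ hκ₂ in
/-- **THE WEIGHT IS A CHARACTER.**  On the compact group `[U(1)]` the continuous function `w = ((charCM χ₂ · κ₂) ∘ cosetCongr e) · κ₁` is
multiplicative with `w 1 = 1`, hence unitary, hence `w = charInv χ̃` for a Pontryagin-dual element `χ̃` of `[U(1)]`.
[cite: Godement1964, §5 Thm. 4; GelbartRogawski1991, §3.1 Remark p. 457 L4–13] -/
theorem exists_pontryaginDual_charInv_eq :
    ∃ χ : PontryaginDual (↥(relNormOneIdeles (↥(maximalRealSubfield L)) L) ⧸ relNormOneRat (↥(maximalRealSubfield L)) L),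
      charInv χ =
        ((Literature.RepresentationTheory.CompactGroups.charCM χ₂ * κ₂).comp
              ⟨cosetCongr (cmLineTorusEquiv (L : Type) (dW Sw 0) (dW_ne Sw 0)) (relNormOneRat (↥(maximalRealSubfield L)) L)
                  (CMRat (L : Type) (lineVec (L : Type) (dW Sw 0))) (cmLineTorusEquiv_mem_CMRat_iff (L : Type) (dW Sw 0) (dW_ne Sw 0)),
                continuous_cosetCongr _ _ _ _ (continuous_cmLineTorusEquiv (L : Type) (dW Sw 0) (dW_ne Sw 0))⟩ * κ₁) :=
  exists_pontryaginDual_charInv_eq_of _ (pinWeight_one V Sw hGR hGR₀ hGR₁ η₀ κ₁ hκ₁ ĉ κ₂ hκ₂ χ₂)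
    (pinWeight_mul V Sw hGR hGR₀ hGR₁ η₀ κ₁ hκ₁ ĉ κ₂ hκ₂ χ₂)

/-! ## §2 The `(χ)`-row for a character with `charInv χ̃ = w` -/

section ChiRow

variable (χ : PontryaginDual (↥(relNormOneIdeles (↥(maximalRealSubfield L)) L) ⧸ relNormOneRat (↥(maximalRealSubfield L)) L))
  (hχ : ∀ t : ↥(relNormOneIdeles (↥(maximalRealSubfield L)) L),
    charInv χ (QuotientGroup.mk t) =
      ((χ₂ (QuotientGroup.mk (cmLineTorusEquiv (L : Type) (dW Sw 0) (dW_ne Sw 0) t)) : Circle) : ℂ) * κ₂ (QuotientGroup.mk (cmLineTorusEquiv (L : Type) (dW Sw 0) (dW_ne Sw 0) t)) * κ₁ (QuotientGroup.mk t))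
  (φ : D.Uf → UfZero Sw) (hto : ∀ u, D.toIdele u = finLineTorusIdeles (L : Type) (dW Sw 0) (dW_ne Sw 0) (φ u))

include hκ₁ hκ₂ hχ hto in
/-- **the `(χ)`-row in `ℂ`**: `D.chiFin χ̃ u = finCharZero … η₀ (1, φ u) · (ĉ(1 ⊗ (1_∞, φ u)) · χ₂([(1_∞, φ u)]))`.
[cite: Liu2021, proof of Prop. 4.13 (l. 2145); App. D §D.1 Step 3 (l. 5219–5221)] [cite: GelbartRogawski1991, §3.1 Remark p. 457 L4–13] -/
theorem coe_chiFin_eq_of_charInv_eq (u : D.Uf) :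
    ((D.chiFin χ u : ℂˣ) : ℂ) =
      ((finCharZero V Sw hGR hGR₀ hGR₁ η₀ (1, φ u) : ℂˣ) : ℂ) *
        (((ĉ (UnitaryGroup.adelicInr (↥(maximalRealSubfield L)) (L : Type) (IsCMField.complexConj L) 3 1
            (Matrix.diagonal (frameD V)) (Matrix.diagonal (lineVec (L : Type) (dW Sw 0)))
            (UnitaryGroup.finAdelicToAdelic (↥(maximalRealSubfield L)) (L : Type) (IsCMField.complexConj L) 1
            (Matrix.diagonal (lineVec (L : Type) (dW Sw 0))) (φ u))) : ℂˣ) : ℂ) *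
          ((χ₂ (QuotientGroup.mk
            (UnitaryGroup.finAdelicToAdelic (↥(maximalRealSubfield L)) (L : Type) (IsCMField.complexConj L) 1
            (Matrix.diagonal (lineVec (L : Type) (dW Sw 0))) (φ u))) : Circle) : ℂ)) := by
  rw [ThetaDistDatum.coe_chiFin_apply, hto, ← map_inv, ← charInv_apply, hχ, hκ₂, hκ₁, finCharZero_one_eq_twistMultiplier V Sw hGR hGR₀ hGR₁ η₀ (φ u),
    cmLineTorusEquiv_finLineTorusIdeles]
  ring

include hκ₁ hκ₂ hχ hto in
/-- **THE `(χ)`-ROW** (in `ℂˣ`, the shape of `hχ` of ★ `exists_holTheta_atLine_of_inputs` with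
`χ₁ := (ĉ ∘ adelicInr ∘ finAdelicToAdelic) · (toUnits ∘ χ₂ ∘ mk ∘ finAdelicToAdelic)`):
`D.chiFin χ̃ u = finCharZero … η₀ (1, φ u) · (ĉ (1 ⊗ (1_∞, φ u)) · toUnits (χ₂ [(1_∞, φ u)]))`.
[cite: Liu2021, proof of Prop. 4.13 (l. 2145); App. D §D.1 Step 3 (l. 5219–5221)] [cite: GelbartRogawski1991, §3.1 Remark p. 457 L4–13] -/
theorem chiFin_eq_of_charInv_eq (u : D.Uf) :
    D.chiFin χ u =
      finCharZero V Sw hGR hGR₀ hGR₁ η₀ (1, φ u) *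
        (ĉ (UnitaryGroup.adelicInr (↥(maximalRealSubfield L)) (L : Type) (IsCMField.complexConj L) 3 1
            (Matrix.diagonal (frameD V)) (Matrix.diagonal (lineVec (L : Type) (dW Sw 0)))
            (UnitaryGroup.finAdelicToAdelic (↥(maximalRealSubfield L)) (L : Type) (IsCMField.complexConj L) 1
            (Matrix.diagonal (lineVec (L : Type) (dW Sw 0))) (φ u))) *
          Circle.toUnits (χ₂ (QuotientGroup.mk
            (UnitaryGroup.finAdelicToAdelic (↥(maximalRealSubfield L)) (L : Type) (IsCMField.complexConj L) 1
            (Matrix.diagonal (lineVec (L : Type) (dW Sw 0))) (φ u))))) :=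
  Units.ext (by
    rw [coe_chiFin_eq_of_charInv_eq V hV Sw hGR hGR₀ hGR₁ η₀ S D κ₁ hκ₁ ĉ κ₂ hκ₂ χ₂ χ hχ φ hto u, Units.val_mul, Units.val_mul,
      Circle.toUnits_apply, Units.val_mk0])

end ChiRow

/-! ## §3 Assembled with the `hne` bridge: ONE `χ̃` with `charInv χ̃ = w`, `hne`, and the `(χ)`-row -/

section Assembled

variable
  -- S6's datum at the ABSTRACT splitting `splittingOf hGR₀` (its majorants and index set)
  (hρ₀ : HasThetaMajorants fun
    (p : CMAdelic (L : Type) (frameD V) × CMAdelic (L : Type) (lineVec (L : Type) (dW Sw 0)))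
    (Φ : piSchwartzBruhat (↥(maximalRealSubfield L)) (Fin 3)) =>
      cmPairRep (L : Type) e₁ (frameD V) (frameD_real V) (frameD_ne V) (lineVec (L : Type) (dW Sw 0))
        (fun _ => dW_real Sw 0) (fun _ => dW_ne Sw 0) hGR₀ p Φ)
  (SK₀ : Set (piSchwartzBruhat (↥(maximalRealSubfield L)) (Fin 3)))
  (hSK₀ : ∀ (h : CMAdelic (L : Type) (lineVec (L : Type) (dW Sw 0))) (Φ : piSchwartzBruhat (↥(maximalRealSubfield L)) (Fin 3)),
    Φ ∈ SK₀ → cmPairRep (L : Type) e₁ (frameD V) (frameD_real V) (frameD_ne V) (lineVec (L : Type) (dW Sw 0))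
      (fun _ => dW_real Sw 0) (fun _ => dW_ne Sw 0) hGR₀ (1, h) Φ ∈ SK₀)
  -- S6's datum at the PIN's explicit splitting `s`, with `splittingOf hGR₀ = s ⊗ ĉ`
  {s : ↥(UnitaryGroup.adelicPair (↥(maximalRealSubfield L)) (L : Type) (IsCMField.complexConj L) 3 1
      (Matrix.diagonal (frameD V)) (Matrix.diagonal (lineVec (L : Type) (dW Sw 0)))) →*
    adelicMpCont (↥(maximalRealSubfield L)) (Fin 3)
      (adelicGram (↥(maximalRealSubfield L)) e₁ (realDiagonal (L : Type) (frameD V) (frameD_real V))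
        (realDiagonal (L : Type) (lineVec (L : Type) (dW Sw 0)) fun _ => dW_real Sw 0))}
  (hs : (cmSplittingDatum (L : Type) e₁ (frameD V) (frameD_real V) (frameD_ne V) (lineVec (L : Type) (dW Sw 0))
    (fun _ => dW_real Sw 0) (fun _ => dW_ne Sw 0)).IsCompatible s)
  (heq : splittingOf (↥(maximalRealSubfield L)) (L : Type) (IsCMField.complexConj L) 3 1 e₁ (Matrix.diagonal (frameD V))
      (Matrix.diagonal (lineVec (L : Type) (dW Sw 0))) (complexConj_imagUnit (L : Type)) (imagUnit_ne_zero (L : Type))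
      (imagUnit_mul_self (L : Type)) (realDiagonal_isSymm (L : Type) (frameD V) (frameD_real V))
      (realDiagonal_isSymm (L : Type) (lineVec (L : Type) (dW Sw 0)) fun _ => dW_real Sw 0)
      (isUnit_det_realDiagonal (L : Type) (frameD V) (frameD_real V) (frameD_ne V))
      (isUnit_det_realDiagonal (L : Type) (lineVec (L : Type) (dW Sw 0)) (fun _ => dW_real Sw 0) fun _ => dW_ne Sw 0)
      (realDiagonal_map (L : Type) (frameD V) (frameD_real V)).symm
      (realDiagonal_map (L : Type) (lineVec (L : Type) (dW Sw 0)) fun _ => dW_real Sw 0).symm hGR₀ =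
    adelicMpCont.twist (↥(maximalRealSubfield L)) (Fin 3) _ s ĉ)
  (hρ : HasThetaMajorants fun
    (p : CMAdelic (L : Type) (frameD V) × CMAdelic (L : Type) (lineVec (L : Type) (dW Sw 0)))
    (Φ : piSchwartzBruhat (↥(maximalRealSubfield L)) (Fin 3)) =>
      pairRep (↥(maximalRealSubfield L)) (L : Type) (IsCMField.complexConj L) 3 1 e₁ (Matrix.diagonal (frameD V))
        (Matrix.diagonal (lineVec (L : Type) (dW Sw 0))) s p Φ)
  (SK : Set (piSchwartzBruhat (↥(maximalRealSubfield L)) (Fin 3)))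
  (hSK : ∀ (h : CMAdelic (L : Type) (lineVec (L : Type) (dW Sw 0))) (Φ : piSchwartzBruhat (↥(maximalRealSubfield L)) (Fin 3)),
    Φ ∈ SK → pairRep (↥(maximalRealSubfield L)) (L : Type) (IsCMField.complexConj L) 3 1 e₁ (Matrix.diagonal (frameD V))
      (Matrix.diagonal (lineVec (L : Type) (dW Sw 0))) s (1, h) Φ ∈ SK)
  [MeasurableSpace (CMAdelic (L : Type) (lineVec (L : Type) (dW Sw 0)) ⧸ CMRat (L : Type) (lineVec (L : Type) (dW Sw 0)))]
  [BorelSpace (CMAdelic (L : Type) (lineVec (L : Type) (dW Sw 0)) ⧸ CMRat (L : Type) (lineVec (L : Type) (dW Sw 0)))]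
  [CompactSpace (CMAdelic (L : Type) (frameD V) ⧸ CMRat (L : Type) (frameD V))]
  [CompactSpace (CMAdelic (L : Type) (lineVec (L : Type) (dW Sw 0)) ⧸ CMRat (L : Type) (lineVec (L : Type) (dW Sw 0)))]

include hSω heq hρ₀ SK₀ hSK₀ hκ₁ hκ₂ in
/-- **`hne` for `χ̃`**: if `charInv χ̃ = w` and the pin theta lift of `D.Φarch ℓ ⊗ Φ_f` at `charCM χ₂` is non-zero, then
`∃ Φ_f', D.dist (charInv χ̃) Φ_f' ≠ 0` (★ `exists_dist_ne_zero_of_pin_thetaLift_ne_zero`, rewritten).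
[cite: Li1992, p. 178; Liu2021, proof of Prop. 4.13 (l. 2145)] -/
theorem exists_dist_charInv_ne_zero_of_pin_thetaLift_ne_zero (χ : PontryaginDual (↥(relNormOneIdeles (↥(maximalRealSubfield L)) L) ⧸ relNormOneRat (↥(maximalRealSubfield L)) L))
    (hχw : charInv χ =
        ((Literature.RepresentationTheory.CompactGroups.charCM χ₂ * κ₂).comp
              ⟨cosetCongr (cmLineTorusEquiv (L : Type) (dW Sw 0) (dW_ne Sw 0)) (relNormOneRat (↥(maximalRealSubfield L)) L)
                  (CMRat (L : Type) (lineVec (L : Type) (dW Sw 0))) (cmLineTorusEquiv_mem_CMRat_iff (L : Type) (dW Sw 0) (dW_ne Sw 0)),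
                continuous_cosetCongr _ _ _ _ (continuous_cmLineTorusEquiv (L : Type) (dW Sw 0) (dW_ne Sw 0))⟩ * κ₁))
    {ℓ : Module.Dual ℂ (Fin 2 → ℂ)} {Φf : FinSB (↥(maximalRealSubfield L)) (Fin 3)}
    (h : (thetaKernelDatum (↥(maximalRealSubfield L)) (L : Type) (IsCMField.complexConj L) 3 1 e₁ (Matrix.diagonal (frameD V))
          (Matrix.diagonal (lineVec (L : Type) (dW Sw 0))) (complexConj_imagUnit (L : Type)) (imagUnit_ne_zero (L : Type))
          (imagUnit_mul_self (L : Type)) (realDiagonal_isSymm (L : Type) (frameD V) (frameD_real V))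
          (realDiagonal_isSymm (L : Type) (lineVec (L : Type) (dW Sw 0)) fun _ => dW_real Sw 0)
          (isUnit_det_realDiagonal (L : Type) (frameD V) (frameD_real V) (frameD_ne V))
          (isUnit_det_realDiagonal (L : Type) (lineVec (L : Type) (dW Sw 0)) (fun _ => dW_real Sw 0) fun _ => dW_ne Sw 0)
          (realDiagonal_map (L : Type) (frameD V) (frameD_real V)).symm
          (realDiagonal_map (L : Type) (lineVec (L : Type) (dW Sw 0)) fun _ => dW_real Sw 0).symm s hs hρ SK hSK).thetaLift
        ((probHaarRelNormOneQuot (↥(maximalRealSubfield L)) (L : Type)).map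
          (cosetCongr (cmLineTorusEquiv (L : Type) (dW Sw 0) (dW_ne Sw 0)) (relNormOneRat (↥(maximalRealSubfield L)) L)
            (CMRat (L : Type) (lineVec (L : Type) (dW Sw 0))) (cmLineTorusEquiv_mem_CMRat_iff (L : Type) (dW Sw 0) (dW_ne Sw 0))))
        (piSchwartzBruhatEquiv (↥(maximalRealSubfield L)) (Fin 3) (D.Φarch ℓ ⊗ₜ[ℂ] Φf)) (Literature.RepresentationTheory.CompactGroups.charCM χ₂) ≠ 0) :
    ∃ Φf' : FinSB (↥(maximalRealSubfield L)) (Fin 3), D.dist (charInv χ) Φf' ≠ 0 := by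
  rw [hχw]
  exact exists_dist_ne_zero_of_pin_thetaLift_ne_zero V hV Sw hGR hGR₀ hGR₁ hGR₂ hGR₃ η₀ η₁ η₂ η₃ S hSω D hρ₀ SK₀ hSK₀ hs ĉ heq hρ SK hSK
    κ₁ hκ₁ κ₂ hκ₂ _ h

include hSω heq hρ₀ SK₀ hSK₀ hκ₁ hκ₂ in
/-- **THE `(χ)`-ROW AND THE `hne`-ROW TOGETHER.**  From ONE non-zero theta lift of S6's pair at the pin splitting `s`, of
`D.Φarch ℓ ⊗ Φ_f` and `charCM χ₂`: there is `χ̃ : PontryaginDual [U(1)]` with `charInv χ̃ = ((charCM χ₂ · κ₂) ∘ cosetCongr e) · κ₁`,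
`∃ Φ_f', D.dist (charInv χ̃) Φ_f' ≠ 0`, and `D.chiFin χ̃ u = finCharZero … η₀ (1, φ u) · (ĉ (1 ⊗ (1_∞, φ u)) · toUnits (χ₂ [(1_∞, φ u)]))`
for every `u` — the rows `hne`, `hχ` of ★ `exists_holTheta_atLine_of_inputs` for the same `χ̃`, no rationality input.
[cite: Li1992, p. 178; GelbartRogawski1991, §3.1 Remark p. 457 L4–13; Liu2021, proof of Prop. 4.13 (l. 2145); Godement1964, §5 Thm. 4] -/
theorem exists_chiRow_and_hne_of_pin_thetaLift_ne_zero
    (φ : D.Uf → UfZero Sw) (hto : ∀ u, D.toIdele u = finLineTorusIdeles (L : Type) (dW Sw 0) (dW_ne Sw 0) (φ u))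
    {ℓ : Module.Dual ℂ (Fin 2 → ℂ)} {Φf : FinSB (↥(maximalRealSubfield L)) (Fin 3)}
    (h : (thetaKernelDatum (↥(maximalRealSubfield L)) (L : Type) (IsCMField.complexConj L) 3 1 e₁ (Matrix.diagonal (frameD V))
          (Matrix.diagonal (lineVec (L : Type) (dW Sw 0))) (complexConj_imagUnit (L : Type)) (imagUnit_ne_zero (L : Type))
          (imagUnit_mul_self (L : Type)) (realDiagonal_isSymm (L : Type) (frameD V) (frameD_real V))
          (realDiagonal_isSymm (L : Type) (lineVec (L : Type) (dW Sw 0)) fun _ => dW_real Sw 0)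
          (isUnit_det_realDiagonal (L : Type) (frameD V) (frameD_real V) (frameD_ne V))
          (isUnit_det_realDiagonal (L : Type) (lineVec (L : Type) (dW Sw 0)) (fun _ => dW_real Sw 0) fun _ => dW_ne Sw 0)
          (realDiagonal_map (L : Type) (frameD V) (frameD_real V)).symm
          (realDiagonal_map (L : Type) (lineVec (L : Type) (dW Sw 0)) fun _ => dW_real Sw 0).symm s hs hρ SK hSK).thetaLift
        ((probHaarRelNormOneQuot (↥(maximalRealSubfield L)) (L : Type)).map
          (cosetCongr (cmLineTorusEquiv (L : Type) (dW Sw 0) (dW_ne Sw 0)) (relNormOneRat (↥(maximalRealSubfield L)) L)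
            (CMRat (L : Type) (lineVec (L : Type) (dW Sw 0))) (cmLineTorusEquiv_mem_CMRat_iff (L : Type) (dW Sw 0) (dW_ne Sw 0))))
        (piSchwartzBruhatEquiv (↥(maximalRealSubfield L)) (Fin 3) (D.Φarch ℓ ⊗ₜ[ℂ] Φf)) (Literature.RepresentationTheory.CompactGroups.charCM χ₂) ≠ 0) :
    ∃ χ : PontryaginDual (↥(relNormOneIdeles (↥(maximalRealSubfield L)) L) ⧸ relNormOneRat (↥(maximalRealSubfield L)) L),
      charInv χ =
        ((Literature.RepresentationTheory.CompactGroups.charCM χ₂ * κ₂).comp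
              ⟨cosetCongr (cmLineTorusEquiv (L : Type) (dW Sw 0) (dW_ne Sw 0)) (relNormOneRat (↥(maximalRealSubfield L)) L)
                  (CMRat (L : Type) (lineVec (L : Type) (dW Sw 0))) (cmLineTorusEquiv_mem_CMRat_iff (L : Type) (dW Sw 0) (dW_ne Sw 0)),
                continuous_cosetCongr _ _ _ _ (continuous_cmLineTorusEquiv (L : Type) (dW Sw 0) (dW_ne Sw 0))⟩ * κ₁) ∧
      (∃ Φf' : FinSB (↥(maximalRealSubfield L)) (Fin 3), D.dist (charInv χ) Φf' ≠ 0) ∧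
      ∀ u : D.Uf,
        D.chiFin χ u =
          finCharZero V Sw hGR hGR₀ hGR₁ η₀ (1, φ u) *
            (ĉ (UnitaryGroup.adelicInr (↥(maximalRealSubfield L)) (L : Type) (IsCMField.complexConj L) 3 1
            (Matrix.diagonal (frameD V)) (Matrix.diagonal (lineVec (L : Type) (dW Sw 0)))
                (UnitaryGroup.finAdelicToAdelic (↥(maximalRealSubfield L)) (L : Type) (IsCMField.complexConj L) 1
            (Matrix.diagonal (lineVec (L : Type) (dW Sw 0))) (φ u))) *
              Circle.toUnits (χ₂ (QuotientGroup.mk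
                (UnitaryGroup.finAdelicToAdelic (↥(maximalRealSubfield L)) (L : Type) (IsCMField.complexConj L) 1
            (Matrix.diagonal (lineVec (L : Type) (dW Sw 0))) (φ u))))) := by
  obtain ⟨χ, hχw⟩ := exists_pontryaginDual_charInv_eq V Sw hGR hGR₀ hGR₁ η₀ κ₁ hκ₁ ĉ κ₂ hκ₂ χ₂
  refine ⟨χ, hχw, exists_dist_charInv_ne_zero_of_pin_thetaLift_ne_zero V hV Sw hGR hGR₀ hGR₁ hGR₂ hGR₃ η₀ η₁ η₂ η₃ S hSω D κ₁ hκ₁ ĉ κ₂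
    hκ₂ χ₂ hρ₀ SK₀ hSK₀ hs heq hρ SK hSK χ hχw h, fun u => ?_⟩
  exact chiFin_eq_of_charInv_eq V hV Sw hGR hGR₀ hGR₁ η₀ S D κ₁ hκ₁ ĉ κ₂ hκ₂ χ₂ χ (fun t => by rw [hχw]; rfl) φ hto u

end Assembled

end Summit.HodgeConjecture.HodgeConjecture.Cruxes.H413.RallisTransport

end
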